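import Summits.Schanuel.Schanuel.Theorems.ZilberEacSequenceRelation
import HarnessLib

/-!
# Density from two coordinates with `ℚ`-independent growth exponents (THEOREM I)

Zilber's Exponential-Algebraic Closedness, case ladder (host summit Schanuel, cell `pub-schanuel`,
seat 2, gen 8).  A third analytic endgame for THEOREM H
(`ZilberEacSequenceRelation.exists_polyPoly_relation_of_forall_aeval_eq_zero`: along a
Zariski-non-generic sequence of points of an irreducible surface ANY two coordinates satisfy a
nonzero relation `H ∈ ℂ[s][t]`), after THEOREM G (growth of `|Re x| / log ‖x‖`) and THEOREM G′
(non-clustering of a bounded multiplicative coordinate):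

* `polyPoly_eq_zero_of_logGrowth` — **irrational growth exponents kill every relation.**  If
  `log ‖u_m‖ = κ T_m + O(1)` and `log ‖v_m‖ = μ T_m + O(1)` with `T_m → ∞` and `κ, μ` linearly
  independent over `ℤ` (e.g. `κ = d ≠ 0`, `μ = a d`, `a ∉ ℚ`), then no nonzero `H ∈ ℂ[s][t]` has
  `H(u_m)(v_m) = 0` for all large `m`: the monomials `u^i v^j` have sizes `e^{(iκ + jμ) T_m + O(1)}`
  with pairwise DISTINCT exponents `iκ + jμ`, so exactly one of them dominates
  (`eventually_sum_ne_zero_of_expGrowth`).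
* THEOREM I (`unprojectedDense_of_logGrowth`): exponential points `p_m` of an irreducible closed
  `S ⊆ ℂⁿ × ℂⁿ` of dimension `≤ 2` two of whose coordinates grow like that are Zariski dense in `S`
  (`UnprojectedDense S`).

This is the elimination behind the density of the MOVING-TARGET families over lines of real
irrational slope (`ZilberEacMovingLine`): near the lattice centres `|y₀| ≍ m^{d}`, `|y₁| ≍ m^{a d}`.

HONEST FRAMING: general sufficient conditions for instances of an OPEN question (Mantova–Masser
2024 §1, the density of the unprojected exponential points); `EC(3,2)` OPEN; nothing here bears on
Schanuel's conjecture (EAC ⇏ SC).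
-/

noncomputable section

open MvPolynomial Filter Topology
open Literature.NumberTheory.Transcendental Literature.ModelTheory.Zilber

set_option linter.dupNamespace false

namespace Summit.Schanuel.Schanuel.Theorems

/-! ## Part A. A finite sum with a unique dominant exponential term does not vanish -/

section Dominance

variable {ι : Type*} [DecidableEq ι]

/-- If one term of a finite sum of complex numbers exceeds in norm the sum of the norms of all the
others, the sum is nonzero. [folklore] -/
theorem sum_ne_zero_of_norm_lt {S : Finset ι} {s₀ : ι} (hs₀ : s₀ ∈ S) (z : ι → ℂ)
    (h : ∑ s ∈ S.erase s₀, ‖z s‖ < ‖z s₀‖) : ∑ s ∈ S, z s ≠ 0 := by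
  intro h0
  rw [← Finset.add_sum_erase S z hs₀] at h0
  have h1 : z s₀ = -∑ s ∈ S.erase s₀, z s := eq_neg_of_add_eq_zero_left h0
  have h2 : ‖z s₀‖ ≤ ∑ s ∈ S.erase s₀, ‖z s‖ := by
    rw [h1, norm_neg]; exact norm_sum_le _ _
  linarith

/-- **Dominance lemma.**  Let `S` be a finite nonempty index set, `w` real weights injective on
`S`, `T_m → ∞`, and `z_m(s) ∈ ℂ` with `e^{w_s T_m - E} ≤ ‖z_m(s)‖ ≤ e^{w_s T_m + E}` for all
`s ∈ S` and all large `m`.  Then `Σ_{s ∈ S} z_m(s) ≠ 0` for all large `m` (the term of largest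
weight dominates). [folklore] -/
theorem eventually_sum_ne_zero_of_expGrowth (S : Finset ι) (hS : S.Nonempty) (w : ι → ℝ)
    (hw : Set.InjOn w S) {T : ℕ → ℝ} (hT : Tendsto T atTop atTop) (E : ℝ) (z : ℕ → ι → ℂ)
    (hz : ∀ᶠ m in atTop, ∀ s ∈ S,
      Real.exp (w s * T m - E) ≤ ‖z m s‖ ∧ ‖z m s‖ ≤ Real.exp (w s * T m + E)) :
    ∀ᶠ m in atTop, ∑ s ∈ S, z m s ≠ 0 := by
  obtain ⟨s₀, hs₀, hmax⟩ := S.exists_max_image w hS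
  have hlt : ∀ s ∈ S.erase s₀, w s < w s₀ := by
    intro s hs
    obtain ⟨hne, hsS⟩ := Finset.mem_erase.1 hs
    exact lt_of_le_of_ne (hmax s hsS) fun h => hne (hw hsS hs₀ h)
  -- the ratios `e^{(w s - w s₀) T + 2E}` tend to `0`
  have hratio : Tendsto (fun m => ∑ s ∈ S.erase s₀, Real.exp ((w s - w s₀) * T m + 2 * E))
      atTop (𝓝 0) := by
    rw [show (0 : ℝ) = ∑ s ∈ S.erase s₀, (0 : ℝ) by simp]
    refine tendsto_finsetSum _ fun s hs => ?_
    have hneg : w s - w s₀ < 0 := sub_neg.2 (hlt s hs)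
    have h1 : Tendsto (fun m => (w s - w s₀) * T m + 2 * E) atTop atBot :=
      tendsto_atBot_add_const_right _ _ (hT.const_mul_atTop_of_neg hneg)
    exact Real.tendsto_exp_atBot.comp h1
  filter_upwards [hz, hratio.eventually (gt_mem_nhds zero_lt_one)] with m hm hsmall
  have hpos : 0 < ‖z m s₀‖ := lt_of_lt_of_le (Real.exp_pos _) (hm s₀ hs₀).1
  refine sum_ne_zero_of_norm_lt hs₀ (z m) ?_
  have hterm : ∀ s ∈ S.erase s₀,
      ‖z m s‖ ≤ Real.exp ((w s - w s₀) * T m + 2 * E) * ‖z m s₀‖ := by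
    intro s hs
    have hsS : s ∈ S := (Finset.mem_erase.1 hs).2
    calc ‖z m s‖ ≤ Real.exp (w s * T m + E) := (hm s hsS).2
      _ = Real.exp ((w s - w s₀) * T m + 2 * E) * Real.exp (w s₀ * T m - E) := by
          rw [← Real.exp_add]; ring_nf
      _ ≤ Real.exp ((w s - w s₀) * T m + 2 * E) * ‖z m s₀‖ :=
          mul_le_mul_of_nonneg_left (hm s₀ hs₀).1 (Real.exp_pos _).le
  calc ∑ s ∈ S.erase s₀, ‖z m s‖
      ≤ ∑ s ∈ S.erase s₀, Real.exp ((w s - w s₀) * T m + 2 * E) * ‖z m s₀‖ :=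
        Finset.sum_le_sum hterm
    _ = (∑ s ∈ S.erase s₀, Real.exp ((w s - w s₀) * T m + 2 * E)) * ‖z m s₀‖ := by
        rw [Finset.sum_mul]
    _ < 1 * ‖z m s₀‖ := mul_lt_mul_of_pos_right hsmall hpos
    _ = ‖z m s₀‖ := one_mul _

end Dominance

/-! ## Part B. Irrational growth exponents kill every relation `H ∈ ℂ[s][t]` -/

section Elimination

/-- `H(u)(v)` as the double sum `Σ_{i < N, j ≤ deg H} H_{j,i} u^i v^j` over a coefficient rectangle.
[folklore] -/
theorem polyPoly_eval_eq_sum (H : Polynomial (Polynomial ℂ)) {N : ℕ}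
    (hN : ∀ j, (H.coeff j).natDegree < N) (u v : ℂ) :
    (H.map (Polynomial.evalRingHom u)).eval v =
      ∑ p ∈ Finset.range N ×ˢ Finset.range (H.natDegree + 1),
        (H.coeff p.2).coeff p.1 * u ^ p.1 * v ^ p.2 := by
  rw [Polynomial.eval_map, Polynomial.eval₂_eq_sum_range, Finset.sum_product_right]
  refine Finset.sum_congr rfl fun j _ => ?_
  rw [Polynomial.coe_evalRingHom, Polynomial.eval_eq_sum_range' (hN j), Finset.sum_mul]

/-- `ℤ`-independence of `d` and `a d` for irrational `a` and `d ≠ 0`: the shape of hypothesis used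
below (`κ = d`, `μ = a d`). [folklore] -/
theorem intIndep_of_irrational {a : ℝ} (ha : Irrational a) {d : ℝ} (hd : d ≠ 0) (i j : ℤ)
    (h : (i : ℝ) * d + j * (a * d) = 0) : i = 0 ∧ j = 0 := by
  have h1 : (i : ℝ) + j * a = 0 := by
    have : d * ((i : ℝ) + j * a) = 0 := by linear_combination h
    exact (mul_eq_zero.1 this).resolve_left hd
  by_cases hj : j = 0
  · subst hj
    simp only [Int.cast_zero, zero_mul, add_zero, Int.cast_eq_zero] at h1
    exact ⟨h1, rfl⟩
  · exfalso
    have hj' : (j : ℝ) ≠ 0 := by exact_mod_cast hj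
    apply ha
    refine ⟨(-i : ℚ) / j, ?_⟩
    push_cast
    field_simp
    linear_combination -h1

/-- **Irrational growth exponents kill every two-variable relation.**  Let `u_m, v_m ∈ ℂˣ` with
`|log ‖u_m‖ - κ T_m| ≤ E`, `|log ‖v_m‖ - μ T_m| ≤ E` for all large `m`, where `T_m → ∞` and
`i κ + j μ = 0` (`i, j ∈ ℤ`) only for `i = j = 0`.  If `H ∈ ℂ[s][t]` has `H(u_m)(v_m) = 0` for all
large `m`, then `H = 0`.  (The monomials `H_{j,i} u^i v^j` have norms `e^{(iκ + jμ)T_m + O(1)}` with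
pairwise distinct exponents; the largest one dominates.) [folklore] -/
theorem polyPoly_eq_zero_of_logGrowth (H : Polynomial (Polynomial ℂ)) {u v : ℕ → ℂ}
    {T : ℕ → ℝ} (hT : Tendsto T atTop atTop) {κ μ E : ℝ}
    (hind : ∀ i j : ℤ, (i : ℝ) * κ + j * μ = 0 → i = 0 ∧ j = 0)
    (hu : ∀ᶠ m in atTop, u m ≠ 0 ∧ |Real.log ‖u m‖ - κ * T m| ≤ E)
    (hv : ∀ᶠ m in atTop, v m ≠ 0 ∧ |Real.log ‖v m‖ - μ * T m| ≤ E)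
    (hH : ∀ᶠ m in atTop, (H.map (Polynomial.evalRingHom (u m))).eval (v m) = 0) : H = 0 := by
  classical
  by_contra hH0
  -- the coefficient rectangle and the support
  set N : ℕ := H.support.sup (fun j => (H.coeff j).natDegree) + 1 with hNdef
  have hN : ∀ j, (H.coeff j).natDegree < N := by
    intro j
    by_cases hj : j ∈ H.support
    · exact Nat.lt_succ_of_le (Finset.le_sup (f := fun j => (H.coeff j).natDegree) hj)
    · rw [Polynomial.notMem_support_iff.1 hj, Polynomial.natDegree_zero]
      exact Nat.succ_pos _
  set R : Finset (ℕ × ℕ) := Finset.range N ×ˢ Finset.range (H.natDegree + 1) with hR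
  set c : ℕ × ℕ → ℂ := fun p => (H.coeff p.2).coeff p.1 with hc
  set S : Finset (ℕ × ℕ) := R.filter fun p => c p ≠ 0 with hSdef
  have hSR : ∀ p ∈ S, p ∈ R ∧ c p ≠ 0 := fun p hp => Finset.mem_filter.1 hp
  -- `S` is nonempty: the leading coefficient of the leading coefficient
  have hS : S.Nonempty := by
    refine ⟨(H.leadingCoeff.natDegree, H.natDegree), Finset.mem_filter.2 ⟨?_, ?_⟩⟩
    · rw [hR, Finset.mem_product, Finset.mem_range, Finset.mem_range]
      exact ⟨hN _, Nat.lt_succ_self _⟩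
    · change (H.coeff H.natDegree).coeff (H.leadingCoeff.natDegree) ≠ 0
      rw [Polynomial.coeff_natDegree]
      exact Polynomial.leadingCoeff_ne_zero.2 (Polynomial.leadingCoeff_ne_zero.2 hH0)
  -- the weights are injective on `ℕ × ℕ`
  set w : ℕ × ℕ → ℝ := fun p => (p.1 : ℝ) * κ + (p.2 : ℝ) * μ with hw
  have hwinj : Set.InjOn w S := by
    intro p _ p' _ h
    have h' : (((p.1 : ℤ) - p'.1 : ℤ) : ℝ) * κ + (((p.2 : ℤ) - p'.2 : ℤ) : ℝ) * μ = 0 := by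
      simp only [hw] at h
      push_cast
      linear_combination h
    obtain ⟨h1, h2⟩ := hind _ _ h'
    exact Prod.ext (by omega) (by omega)
  -- the terms and their two-sided bounds
  set z : ℕ → ℕ × ℕ → ℂ := fun m p => c p * u m ^ p.1 * v m ^ p.2 with hz
  set E' : ℝ := (∑ p ∈ S, |Real.log ‖c p‖|) + ((N : ℝ) + H.natDegree) * E with hE'
  have hbounds : ∀ᶠ m in atTop, ∀ p ∈ S,
      Real.exp (w p * T m - E') ≤ ‖z m p‖ ∧ ‖z m p‖ ≤ Real.exp (w p * T m + E') := by
    filter_upwards [hu, hv] with m hum hvm p hp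
    obtain ⟨hpR, hcp⟩ := hSR p hp
    have hE0 : 0 ≤ E := (abs_nonneg _).trans hum.2
    have hi : (p.1 : ℝ) ≤ N := by
      have := (Finset.mem_range.1 (Finset.mem_product.1 hpR).1).le
      exact_mod_cast this
    have hj : (p.2 : ℝ) ≤ H.natDegree := by
      have := Nat.lt_succ_iff.1 (Finset.mem_range.1 (Finset.mem_product.1 hpR).2)
      exact_mod_cast this
    have hnorm : ‖z m p‖ = Real.exp (Real.log ‖c p‖ + p.1 * Real.log ‖u m‖ +
        p.2 * Real.log ‖v m‖) := by
      rw [Real.exp_add, Real.exp_add, Real.exp_nat_mul, Real.exp_nat_mul,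
        Real.exp_log (norm_pos_iff.2 hcp), Real.exp_log (norm_pos_iff.2 hum.1),
        Real.exp_log (norm_pos_iff.2 hvm.1), hz]
      simp only [norm_mul, norm_pow]
    have hlogc : |Real.log ‖c p‖| ≤ ∑ p ∈ S, |Real.log ‖c p‖| :=
      Finset.single_le_sum (f := fun p => |Real.log ‖c p‖|) (fun _ _ => abs_nonneg _) hp
    have hdev : |Real.log ‖c p‖ + p.1 * Real.log ‖u m‖ + p.2 * Real.log ‖v m‖ - w p * T m|
        ≤ E' := by
      have e : Real.log ‖c p‖ + p.1 * Real.log ‖u m‖ + p.2 * Real.log ‖v m‖ - w p * T m =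
          Real.log ‖c p‖ + p.1 * (Real.log ‖u m‖ - κ * T m) + p.2 * (Real.log ‖v m‖ - μ * T m) := by
        simp only [hw]; ring
      rw [e]
      calc |Real.log ‖c p‖ + p.1 * (Real.log ‖u m‖ - κ * T m) + p.2 * (Real.log ‖v m‖ - μ * T m)|
          ≤ |Real.log ‖c p‖| + |p.1 * (Real.log ‖u m‖ - κ * T m)| +
              |p.2 * (Real.log ‖v m‖ - μ * T m)| := abs_add_three _ _ _
        _ = |Real.log ‖c p‖| + p.1 * |Real.log ‖u m‖ - κ * T m| +
              p.2 * |Real.log ‖v m‖ - μ * T m| := by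
            rw [abs_mul, abs_mul, Nat.abs_cast, Nat.abs_cast]
        _ ≤ (∑ p ∈ S, |Real.log ‖c p‖|) + N * E + H.natDegree * E := by
            gcongr
            · exact hum.2
            · exact hvm.2
        _ = E' := by rw [hE']; ring
    rw [abs_le] at hdev
    rw [hnorm]
    exact ⟨Real.exp_le_exp.2 (by linarith [hdev.1]), Real.exp_le_exp.2 (by linarith [hdev.2])⟩
  have hne := eventually_sum_ne_zero_of_expGrowth S hS w hwinj hT E' z hbounds
  obtain ⟨m, hm1, hm2⟩ := (hne.and hH).exists
  apply hm1
  -- `Σ_S z = Σ_R z = H(u_m)(v_m) = 0`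
  have hSR' : ∑ p ∈ S, z m p = ∑ p ∈ R, z m p := by
    rw [hSdef]
    exact Finset.sum_filter_of_ne fun p _ hzp => by
      intro hcp
      apply hzp
      simp only [hz, hcp, zero_mul]
  rw [hSR', hR, ← hm2, polyPoly_eval_eq_sum H hN]

end Elimination

/-! ## Part C. THEOREM I: density from two coordinates with independent growth exponents -/

section Density

variable {n : ℕ}

/-- **THEOREM I (density from `ℚ`-independent growth exponents).**  Let `S ⊆ ℂⁿ × ℂⁿ` be
irreducible closed with `dim S ≤ 2`, and `p_m ∈ S ∩ Γ_exp` exponential points two of whose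
coordinates `α, β` satisfy `|log ‖p_m(α)‖ - κ T_m| ≤ E`, `|log ‖p_m(β)‖ - μ T_m| ≤ E` for all large
`m`, with `T_m → ∞` and `i κ + j μ ≠ 0` for all `(i, j) ∈ ℤ² ∖ 0`.  Then the exponential points of
`S` are Zariski dense (`UnprojectedDense S`).  Proof: a polynomial vanishing on `S ∩ Γ_exp` but not
on `S` yields by THEOREM H a nonzero `H ∈ ℂ[s][t]` with `H(p_m(α))(p_m(β)) = 0` for all `m`,
impossible by `polyPoly_eq_zero_of_logGrowth`. (new) -/
theorem unprojectedDense_of_logGrowth {S : Set (Fin n ⊕ Fin n → ℂ)} (hS : IsIrreducibleClosed ℂ S)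
    (hdim : zariskiDim ℂ S ≤ (2 : ℕ)) (α β : Fin n ⊕ Fin n) {p : ℕ → Fin n ⊕ Fin n → ℂ}
    (hpS : ∀ m, p m ∈ S) (hpΓ : ∀ m, p m ∈ expGraph ℂ n) {T : ℕ → ℝ}
    (hT : Tendsto T atTop atTop) {κ μ E : ℝ}
    (hind : ∀ i j : ℤ, (i : ℝ) * κ + j * μ = 0 → i = 0 ∧ j = 0)
    (hα : ∀ᶠ m in atTop, p m α ≠ 0 ∧ |Real.log ‖p m α‖ - κ * T m| ≤ E)
    (hβ : ∀ᶠ m in atTop, p m β ≠ 0 ∧ |Real.log ‖p m β‖ - μ * T m| ≤ E) :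
    UnprojectedDense S := by
  refine le_antisymm ?_ (vanishingIdeal_anti_mono Set.inter_subset_left)
  intro f hf
  by_contra hfS
  have hfp : ∀ m, aeval (p m) f = 0 := fun m => (mem_vanishingIdeal_iff.1 hf) _ ⟨hpS m, hpΓ m⟩
  obtain ⟨H, hH0, hH⟩ := exists_polyPoly_relation_of_forall_aeval_eq_zero hS hdim hpS hfS hfp α β
  exact hH0 (polyPoly_eq_zero_of_logGrowth H hT hind hα hβ (Eventually.of_forall hH))

/-- **THEOREM I, the shape used for real-slope lines**: `|log ‖p_m(α)‖ - d T_m| ≤ E` and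
`|log ‖p_m(β)‖ - a d T_m| ≤ E` with `d ≠ 0` and `a` irrational. (new) -/
theorem unprojectedDense_of_logGrowth_irrational {S : Set (Fin n ⊕ Fin n → ℂ)}
    (hS : IsIrreducibleClosed ℂ S) (hdim : zariskiDim ℂ S ≤ (2 : ℕ)) (α β : Fin n ⊕ Fin n)
    {p : ℕ → Fin n ⊕ Fin n → ℂ} (hpS : ∀ m, p m ∈ S) (hpΓ : ∀ m, p m ∈ expGraph ℂ n)
    {T : ℕ → ℝ} (hT : Tendsto T atTop atTop) {a d E : ℝ} (ha : Irrational a) (hd : d ≠ 0)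
    (hα : ∀ᶠ m in atTop, p m α ≠ 0 ∧ |Real.log ‖p m α‖ - d * T m| ≤ E)
    (hβ : ∀ᶠ m in atTop, p m β ≠ 0 ∧ |Real.log ‖p m β‖ - a * d * T m| ≤ E) :
    UnprojectedDense S :=
  unprojectedDense_of_logGrowth hS hdim α β hpS hpΓ hT (κ := d) (μ := a * d) (E := E)
    (fun i j h => intIndep_of_irrational ha hd i j h) hα hβ

end Density

end Summit.Schanuel.Schanuel.Theorems

end
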